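import Mathlib
import Summits.Ventures.HodgeRepro2.T5CyclotomicUnramified
import Summits.Ventures.HodgeRepro2.T5ResidualShape

/-!
# T5ResidualShapeCyclotomic — the residual shape REALISED inside `ℚ(ζ₉₃)`

Tier-5 support (seat p3) for sub-step N2 of `route/T5-N2-route-3.md`, §N2.8.2(d)–(e) («the residual
configuration is REALISABLE»; «residual shape: 2 non-split in K AND 2 split completely in F⁺ (F⁺ of
conductor 31 is p3's example)») and §N2.9.4's pair `(g₂(F⁺), |D_set|) = (3, 3)`.

`T5ResidualShape` (p394867) proved `|D| = 3` from two hypotheses — `2` split completely in the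
cubic `F`, `2` inert in the quadratic `K` — for an abstract sextic `E ⊇ F, K` with `E/F` Galois of
degree 2.  THIS file produces such a sextic: inside ANY `E` with `IsCyclotomicExtension {93} ℚ E`
(`93 = 3·31`), take ANY cubic intermediate field `F` (the cyclic cubic of conductor 31 — `2` splits
completely in it because `ord₉₃(2) = 10` is coprime to `3`: `splitsCompletely_two_cubic`) and ANY
quadratic intermediate field `K` in which `2` is inert (`ℚ(√−3)` is one); then the compositum
`E' = F ⊔ K` is a sextic (`finrank_sup`: coprime degrees ⟹ linearly disjoint), Galois of degree `2`
over `F` (`ℚ(ζ₉₃)/ℚ` is abelian), and EVERY dyadic prime of `F` is non-split in `E'`: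
`D(F, E').ncard = 3` (`ncard_nonSplit_sup`).

The field-level residual configuration of the record therefore exists; N2.8.2(d)'s hermitian
realisation (Landherr) and the dyadic dichotomy that excludes it are the printed inputs of the
record and are not touched.

§2 adds the fourth configuration of N2.9.4, `(g₂(F⁺), |D|) = (3, 0)`: inside ANY `E` with
`IsCyclotomicExtension {31} ℚ E`, with `F` cubic and `K` quadratic (`ℚ(√−31)`, `2` split), `2`
splits completely in the sextic `F ⊔ K` (`ord₃₁(2) = 5` is coprime to `6`), so every dyadic prime
of `F` splits in `F ⊔ K` and `D = ∅` (`nonSplit_sup_eq_empty_31`).  With `T5CyclotomicDyadic`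
(`ℚ(ζ₇)`: `(1, 0)`; `ℚ(ζ₉)`: `(1, 1)`) all four pairs of N2.9.4 are realised by explicit fields.
Uses an L-value-free non-vanishing device: NO (README §8(d)).
-/

namespace Summit.Ventures.HodgeRepro2.T5ResidualShapeCyclotomic

open Ideal NumberField IntermediateField

/-- The ideal `(2)` of `ℤ`. -/
local notation3 "𝒑₂" => (span {((2 : ℕ) : ℤ)} : Ideal ℤ)

/-- `ord₉₃(2) = 10` (`2¹⁰ = 1024 = 11·93 + 1`, no smaller positive power). -/
theorem orderOf_two_zmod_93 : orderOf (2 : ZMod 93) = 10 := by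
  rw [orderOf_eq_iff (by norm_num)]
  refine ⟨by decide, fun k hk hk0 => ?_⟩
  interval_cases k <;> decide

section NinetyThree

variable (E : Type*) [Field E] [NumberField E] [IsCyclotomicExtension {93} ℚ E]
  (F K : IntermediateField ℚ E)

/-- `2` SPLITS COMPLETELY in every cubic subfield of `ℚ(ζ₉₃)` (the cyclic cubic of conductor 31):
`e = f = 1` at every dyadic prime, since `ord₉₃(2) = 10` is coprime to `3`
(`T5CyclotomicUnramified.inertiaDeg_eq_one_of_coprime`). -/
theorem splitsCompletely_two_cubic (hF : Module.finrank ℚ F = 3) :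
    ∀ 𝔭 ∈ 𝒑₂.primesOver (𝓞 F), 𝔭.ramificationIdx ℤ * 𝔭.inertiaDeg ℤ = 1 := by
  intro 𝔭 h𝔭
  haveI := h𝔭.1
  haveI := h𝔭.2
  have hc : Nat.Coprime (orderOf ((2 : ℕ) : ZMod 93)) (Module.finrank ℚ F) := by
    rw [hF]
    have h10 : orderOf ((2 : ℕ) : ZMod 93) = 10 := by exact_mod_cast orderOf_two_zmod_93
    rw [h10]
    decide
  rw [T5CyclotomicUnramified.ramificationIdx_eq_one (m := 93) 2 E F (by decide) 𝔭,
    T5CyclotomicUnramified.inertiaDeg_eq_one_of_coprime (m := 93) 2 E F (by decide) hc 𝔭]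

omit [IsCyclotomicExtension {93} ℚ E] in
/-- The compositum of a cubic and a quadratic subfield is a sextic (coprime degrees ⟹ linearly
disjoint: `IntermediateField.LinearDisjoint.of_finrank_coprime`, `…finrank_sup`). -/
theorem finrank_sup (hF : Module.finrank ℚ F = 3) (hK : Module.finrank ℚ K = 2) :
    Module.finrank ℚ (F ⊔ K : IntermediateField ℚ E) = 6 := by
  have hd : F.LinearDisjoint K :=
    IntermediateField.LinearDisjoint.of_finrank_coprime (by rw [hF, hK]; decide)
  rw [hd.finrank_sup, hF, hK]

/-- THE RESIDUAL SHAPE REALISED: for `F` cubic and `K` quadratic with `2` inert in `K`, inside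
`ℚ(ζ₉₃)`, every dyadic prime of `F` is non-split in the sextic `E' = F ⊔ K` — `D(F, E')` has exactly
`3` elements (`T5ResidualShape.ncard_nonSplit`; `E'/F` is Galois of degree `2` because `E'/ℚ` is
abelian and `[E' : ℚ] = 6`). -/
theorem ncard_nonSplit_sup (hF : Module.finrank ℚ F = 3) (hK : Module.finrank ℚ K = 2)
    (hK2 : ∀ 𝔮 : Ideal (𝓞 K), 𝔮.IsPrime → 𝔮.LiesOver 𝒑₂ → 𝔮.inertiaDeg ℤ = 2) :
    letI : Algebra F (F ⊔ K : IntermediateField ℚ E) := (inclusion le_sup_left).toAlgebra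
    letI : Algebra K (F ⊔ K : IntermediateField ℚ E) := (inclusion le_sup_right).toAlgebra
    {𝔭 ∈ 𝒑₂.primesOver (𝓞 F) |
      (𝔭.primesOver (𝓞 (F ⊔ K : IntermediateField ℚ E))).ncard = 1}.ncard = 3 := by
  letI : Algebra F (F ⊔ K : IntermediateField ℚ E) := (inclusion le_sup_left).toAlgebra
  letI : Algebra K (F ⊔ K : IntermediateField ℚ E) := (inclusion le_sup_right).toAlgebra
  haveI : IsScalarTower ℚ F (F ⊔ K : IntermediateField ℚ E) :=
    IsScalarTower.of_algebraMap_eq (fun _ => rfl)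
  haveI : IsAbelianGalois ℚ E := IsCyclotomicExtension.isAbelianGalois {93} ℚ E
  haveI : IsGalois ℚ (F ⊔ K : IntermediateField ℚ E) :=
    (IsAbelianGalois.tower_bot ℚ (F ⊔ K : IntermediateField ℚ E) E).toIsGalois
  haveI : IsGalois F (F ⊔ K : IntermediateField ℚ E) :=
    IsGalois.tower_top_of_isGalois ℚ F (F ⊔ K : IntermediateField ℚ E)
  haveI : Module.Free F (F ⊔ K : IntermediateField ℚ E) := Module.Free.of_divisionRing _ _
  have h2 : Module.finrank F (F ⊔ K : IntermediateField ℚ E) = 2 := by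
    have := Module.finrank_mul_finrank ℚ F (F ⊔ K : IntermediateField ℚ E)
    rw [hF, finrank_sup E F K hF hK] at this
    omega
  exact T5ResidualShape.ncard_nonSplit (K := K) h2 hK2 (splitsCompletely_two_cubic E F hF) hF

end NinetyThree

section ThirtyOne

variable (E : Type*) [Field E] [NumberField E] [IsCyclotomicExtension {31} ℚ E]
  (F K : IntermediateField ℚ E)

/-- The pair `(3, 0)`: inside `ℚ(ζ₃₁)`, `2` splits completely in the sextic `F ⊔ K` (`ord₃₁(2) = 5`
is coprime to `6`), so every dyadic prime of the cubic `F` has two primes of `F ⊔ K` above it and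
`D(F, F ⊔ K) = ∅`. -/
theorem nonSplit_sup_eq_empty_31 (hF : Module.finrank ℚ F = 3) (hK : Module.finrank ℚ K = 2) :
    letI : Algebra F (F ⊔ K : IntermediateField ℚ E) := (inclusion le_sup_left).toAlgebra
    {𝔭 ∈ 𝒑₂.primesOver (𝓞 F) |
      (𝔭.primesOver (𝓞 (F ⊔ K : IntermediateField ℚ E))).ncard = 1} = ∅ := by
  letI : Algebra F (F ⊔ K : IntermediateField ℚ E) := (inclusion le_sup_left).toAlgebra
  haveI : IsScalarTower ℚ F (F ⊔ K : IntermediateField ℚ E) :=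
    IsScalarTower.of_algebraMap_eq (fun _ => rfl)
  haveI : IsAbelianGalois ℚ E := IsCyclotomicExtension.isAbelianGalois {31} ℚ E
  haveI : IsGalois ℚ (F ⊔ K : IntermediateField ℚ E) :=
    (IsAbelianGalois.tower_bot ℚ (F ⊔ K : IntermediateField ℚ E) E).toIsGalois
  haveI : IsGalois F (F ⊔ K : IntermediateField ℚ E) :=
    IsGalois.tower_top_of_isGalois ℚ F (F ⊔ K : IntermediateField ℚ E)
  haveI : Module.Free F (F ⊔ K : IntermediateField ℚ E) := Module.Free.of_divisionRing _ _
  have h6 : Module.finrank ℚ (F ⊔ K : IntermediateField ℚ E) = 6 := by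
    have hd : F.LinearDisjoint K :=
      IntermediateField.LinearDisjoint.of_finrank_coprime (by rw [hF, hK]; decide)
    rw [hd.finrank_sup, hF, hK]
  have h2 : Module.finrank F (F ⊔ K : IntermediateField ℚ E) = 2 := by
    have := Module.finrank_mul_finrank ℚ F (F ⊔ K : IntermediateField ℚ E)
    rw [hF, h6] at this
    omega
  rw [Set.sep_eq_empty_iff_mem_false]
  intro 𝔭 h𝔭
  haveI := h𝔭.1
  haveI := h𝔭.2
  obtain ⟨⟨P, hP, hPF⟩⟩ := 𝔭.nonempty_primesOver (S := 𝓞 (F ⊔ K : IntermediateField ℚ E))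
  haveI : P.LiesOver 𝒑₂ := LiesOver.trans P 𝔭 𝒑₂
  -- `e(P|2) = f(P|2) = 1` in the sextic (`ord₃₁(2) = 5` coprime to `6`), hence over `𝔭` too
  have hc : Nat.Coprime (orderOf ((2 : ℕ) : ZMod 31))
      (Module.finrank ℚ (F ⊔ K : IntermediateField ℚ E)) := by
    rw [h6]
    have h5 : orderOf ((2 : ℕ) : ZMod 31) = 5 := by
      exact_mod_cast T5CyclotomicUnramified.orderOf_two_zmod_31
    rw [h5]
    decide
  have hfP : P.inertiaDeg ℤ = 1 :=
    T5CyclotomicUnramified.inertiaDeg_eq_one_of_coprime (m := 31) 2 E _ (by decide) hc P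
  have heP : P.ramificationIdx ℤ = 1 :=
    T5CyclotomicUnramified.ramificationIdx_eq_one (m := 31) 2 E _ (by decide) P
  have hf := inertiaDeg_tower (R := ℤ) 𝔭 P
  rw [hfP] at hf
  have hf' : P.inertiaDeg (𝓞 F) = 1 := Nat.eq_one_of_mul_eq_one_left hf.symm
  have he' : P.ramificationIdx (𝓞 F) = 1 :=
    (T5CyclotomicDyadic.ramificationIdx_eq_one_of_tower 𝔭 P heP).2
  have hg := T5CyclotomicDyadic.ncard_primesOver_mul 𝔭 P
  rw [he', hf', h2] at hg
  omega

end ThirtyOne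

end Summit.Ventures.HodgeRepro2.T5ResidualShapeCyclotomic
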